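import Literature.Claims.NS.ClayVariants
import HarnessLib

/-!
# Claim skeleton (D-0090 NS-CLAIMS, C52): S. V. Ershkov, «On existence of general solution of the
# Navier-Stokes equations for 3D non-stationary incompressible flow», arXiv:1502.01206 v3 (2015)
# = Int. J. Fluid Mech. Res. 42(3) (2015) 206–213 — Helmholtz-split «general solution»

Cell `ns-claims`, row C52 (T3 tail of QUEUE v1.17), typist `ns-claims-typist-12` (lanes: refuter first idle
(PREDICTED-R), ref-2 g2, salvage by family (p1 g2), writer-2, lit-4 (T3 stub)). Text of record: arXiv
1502.01206 **v3** (2015-05-29, PDF-only Word e-print, 13 pp.; = the journal version per the listing) —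
PINNED by the typist (the LOCATORS file is a stub); prose from the lit store `paper:arxiv-1502.01206`,
DISPLAYS reconstructed from the PDF's MathType objects with `pub/ns-claims/ns-claims-lit-3/pdfforms.py`
(typist's folder `src52/forms/p000N_forms.txt`); page = PDF page. Bib `Ershkov2015`. UNREFEREED CLAIM under
adjudication — NOTHING in this file asserts a step: every `Step_k`/`ClaimedTheorem` is a `Prop`; the
`theorem`s are kernel compositions of the paper's own implications. Card `pub/ns-claims/claims/Ershkov2015/
CARD.md` (PREDICTION §4 frozen 2026-08-27T00:52:39Z, sha16 d8e07b7c583556fe).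

## Claimed statement (as printed)

Abstract p. 1 / §8 p. 8: «A new presentation of general solution of Navier-Stokes equations is considered
here. … The field of flow velocity as well as the equation of momentum should be split to the sum of two
components: an irrotational (curl-free) one, and a solenoidal (divergence-free) one. The obviously irrotational
(curl-free) part of equation of momentum used for obtaining of the components of pressure gradient. … So, the
existence of the general solution of Navier-Stokes equations is proved to be the question of existence of the
proper solution for such a PDE-system of linear equations.» **§4 p. 6**: «we should especially note that the
combined system of equations (2.2), (2.4)+(3.1)+(3.2) is equivalent to the initial system of Navier-Stokes
(1.1)+(1.2) in the sense of existence and smoothness of a solution.» §7 p. 7: «each component of the vector of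
flow velocity u_w (with variable curl) is proved evidently to be the solution of a proper Heat equation … the
final solution is proved to be equivalent to the solution of the initial Navier-Stokes system».

Setting §1–§2 pp. 2–4: NS on `ℝ³` in Lamb form (2.1) `∂u/∂t = −∇p − ½∇(u²) + u × w − ∇φ + νΔu`, `∇·u = 0`,
`w = ∇ × u`, body force `F = −∇φ` (central/potential); (2.2) «according to the Helmholtz fundamental theorem»
`u = u_p + u_w`, `u_p ≡ ∇ϕ`, `u_w ≡ ∇ × A`, `∇·u = 0 ⇒ Δϕ = 0`; (2.3) «the 2-nd equation of (2.1) could be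
presented as the sum of two equations below»: **(2.4)** `∇p = −∇φ − ½∇{(u_p + u_w)²}` and **(2.5)**
`∂(u_p + u_w)/∂t = (u_p + u_w) × (∇ × u_w) + ν∇²u_w`; §3 p. 5: «Eq. (2.5) should be presented as the sum of two
equations below»: **(3.1)** `∂u_p/∂t = u_p × w + f`, `f = u_w × w`, **(3.2)** `∂u_w/∂t = ν∇²u_w`, «Equation
(3.2) immediately yields `∂w/∂t = ν∇²w`»; §§4–5 pp. 6–9: the linear system (4.1) for `u_p = {U,V,W}` with
time-dependent coefficients `w`, zero-curl conditions (4.2), fundamental system (5.1), invariant `U²+V²+W² =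
γ²`, Riccati equations (5.3)–(5.4).

RENDERING: classical solutions on `ℝ³ × S` in the tree vocabulary (`IsClassicalNSSolutionOn S ν f u p` with
`f = −∇φ`), decompositions `u = ∇ϕ + u_w` with `u_w` smooth and divergence-free (the paper's `u_w = ∇ × A`;
TODO(general form): the vector potential itself is not typed — only `∇·u_w = 0` is used). The EQUIVALENCE
sentence of §4 p. 6 is the claim: its non-trivial half («every NS solution splits so that (2.4), (3.1), (3.2)
hold») is `ClaimedTheorem`; the other half (sum of the displays gives (2.1)) is bookkeeping.

## Clay delta (reference `Literature.Claims.NS.ClayVariants`, axes Δ1–Δ8)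

Nearest (A) in vocabulary (`ℝ³`, non-stationary, `ν > 0`, potential force ⊇ `f ≡ 0`), but Δ6: the printed
claim is a REDUCTION/«presentation of general solution» («is proved to be the question of existence of the
proper solution for such a PDE-system of linear equations») — no existence or smoothness theorem is stated;
`Step_bridge` records the reading toward (A) (unproved; Δ6 carrier).

## Steps — ORDERED INDEX (TYPING-HYGIENE 11; print order)

Step 1 = (2.1)–(2.2) pp. 3–4 (Lamb form; Helmholtz split; `Δϕ = 0`) — bookkeeping, folded into the
vocabulary · **Step 2 = `Step_24`** (display (2.4) p. 4, «The obviously irrotational (curl-free) part of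
equation of momentum used for obtaining of the components of pressure gradient»: for every solution,
`∇p = −∇φ − ½∇|u|²` pointwise; typist's flag: suspicious — the gradient part of `∂u/∂t − u × w − νΔu` is
assigned nothing) · **Step 3 = `Step_25`** (display (2.5) p. 4 with (2.2)–(2.3): some Helmholtz split of the
solution satisfies `∂u/∂t = u × (∇ × u_w) + νΔu_w`; typist's flag: suspicious) · **Step 4 = `Step_3132`**
((3.1)–(3.2) p. 5: «Eq. (2.5) should be presented as the sum of two equations»: `∂u_p/∂t = u_p × w + u_w × w`
and the HEAT equation `∂u_w/∂t = νΔu_w` for the solenoidal part; typist's flag: suspicious — LOAD-BEARING for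
§§4–5 and for «each component of u_w is proved evidently to be the solution of a proper Heat equation») ·
Step 5 = `Step_heatVorticity` (p. 5 «Equation (3.2) immediately yields ∂w/∂t = ν∇²w», typed for the
vorticity of every solution; typist's flag: suspicious (vortex stretching/transport absent); valid GIVEN
(3.2)) · Step 6 = §§4–5 (4.1)–(5.5) pp. 6–9 (linear ODE system in `t`, Riccati) — downstream of (3.1);
quoted, not typed · Step 7 = `Step_bridge` (§8's reduction sentence read toward (A)).

## COMPOSITION — proved as `claim_of_steps`

`claim_of_steps : Step_24 → Step_3132 → ClaimedTheorem` — PROVED (the decomposition of Step 4 with the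
pressure equation of Step 2). `Step_25` follows from `Step_3132` by adding (3.1) and (3.2) only together with
`u × w = u_p × w + u_w × w` and `w = ∇ × u_w` — recorded in the docstrings, not composed (vector-calculus
bookkeeping the kernel does not need for the verdict).

WHAT THIS IS NOT: not a claim about NS regularity or blow-up; not a claim about any author beyond the
typed locator.
-/

noncomputable section

open Set Function
open scoped ContDiff Laplacian InnerProductSpace
open Literature.Analysis.FluidPDE

namespace Literature.Claims.NS.Ershkov2015

/-- `ℝ³`. [cite: Ershkov2015, §1 (1.1) p. 2] -/
abbrev E3 := EuclideanSpace ℝ (Fin 3)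

/-- The potential body force `F = −∇φ` of §1 p. 2 («we assume here external force F above to be the central
force, which has a potential φ represented by F = −∇φ»). [cite: Ershkov2015, §1 p. 2] -/
def potentialForce (φ : ℝ → E3 → ℝ) (t : ℝ) (x : E3) : E3 := -(gradient (φ t) x)

/-- Half the squared speed, `½ u²` (the Bernoulli term of (2.1)/(2.4)). [cite: Ershkov2015, (2.1) p. 3] -/
def halfSq (u : ℝ → E3 → E3) (t : ℝ) (x : E3) : ℝ := (1 / 2 : ℝ) * ‖u t x‖ ^ 2

/-- **A Helmholtz split of a velocity field on the time set `S`, (2.2) p. 4** («u = u_p + u_w, u_p ≡ ∇ϕ —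
irrotational, u_w — solenoidal … ∇·u = 0 ⇒ Δϕ = 0»): `u(t) = ∇ϕ(t) + u_w(t)` with `ϕ(t)`, `u_w(t)` smooth and
`∇·u_w(t) = 0`. (The vector potential `A` with `u_w = ∇ × A` is not typed.) [cite: Ershkov2015, (2.2) p. 4] -/
structure IsHelmholtzSplitOn (S : Set ℝ) (u : ℝ → E3 → E3) (ϕ : ℝ → E3 → ℝ) (uw : ℝ → E3 → E3) :
    Prop where
  smooth_potential : ∀ t ∈ S, ContDiff ℝ ∞ (ϕ t)
  smooth_solenoidal : ∀ t ∈ S, ContDiff ℝ ∞ (uw t)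
  split : ∀ t ∈ S, ∀ x : E3, u t x = gradient (ϕ t) x + uw t x
  divFree : ∀ t ∈ S, VectorCalculus.IsDivFree (uw t)

/-- Display (2.4) p. 4 for `(u, p)` with force potential `φ`: `∇p = −∇φ − ½∇(u²)` pointwise on `S × ℝ³`.
[cite: Ershkov2015, (2.4) p. 4] -/
def Holds24 (S : Set ℝ) (φ : ℝ → E3 → ℝ) (u : ℝ → E3 → E3) (p : ℝ → E3 → ℝ) : Prop :=
  ∀ t ∈ S, ∀ x : E3, gradient (p t) x = -(gradient (φ t) x) - gradient (halfSq u t) x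

/-- Displays (3.1)–(3.2) p. 5 for a split `u = ∇ϕ + u_w` (with `w = ∇ × u`, `f = u_w × w`):
`∂u_p/∂t = u_p × w + u_w × w` and `∂u_w/∂t = νΔu_w` pointwise on `S × ℝ³` (`[a × b]` = the tree's `cross`).
[cite: Ershkov2015, (3.1)–(3.2) p. 5] -/
def Holds3132 (S : Set ℝ) (ν : ℝ) (u : ℝ → E3 → E3) (ϕ : ℝ → E3 → ℝ) (uw : ℝ → E3 → E3) : Prop :=
  (∀ t ∈ S, ∀ x : E3,
      timeDerivWithin S (fun s y => gradient (ϕ s) y) t x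
        = cross (gradient (ϕ t) x) (curl (u t) x) + cross (uw t x) (curl (u t) x)) ∧
  (∀ t ∈ S, ∀ x : E3, timeDerivWithin S uw t x = ν • (Δ (uw t)) x)

/-! ### The claimed statement -/

/-- **§4 p. 6, the equivalence sentence (non-trivial half), with §8's «general solution»**: «the combined
system of equations (2.2), (2.4)+(3.1)+(3.2) is equivalent to the initial system of Navier-Stokes (1.1)+(1.2)
in the sense of existence and smoothness of a solution» — every classical solution of Navier–Stokes on
`ℝ³ × S` with potential force splits à la Helmholtz so that (2.4), (3.1) and (3.2) hold. Typist's flag: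
suspicious. [cite: Ershkov2015, §4 p. 6; §8 p. 8; (2.2)–(2.5) pp. 3–4; (3.1)–(3.2) p. 5] -/
def ClaimedTheorem : Prop :=
  ∀ (S : Set ℝ) (ν : ℝ), 0 < ν → ∀ (φ : ℝ → E3 → ℝ) (u : ℝ → E3 → E3) (p : ℝ → E3 → ℝ),
    IsClassicalNSSolutionOn S ν (potentialForce φ) u p →
      Holds24 S φ u p ∧ ∃ (ϕ : ℝ → E3 → ℝ) (uw : ℝ → E3 → E3),
        IsHelmholtzSplitOn S u ϕ uw ∧ Holds3132 S ν u ϕ uw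

/-! ### The steps -/

/-- **Step 2 — display (2.4) p. 4** («The obviously irrotational (curl-free) part of equation of momentum
used for obtaining of the components of pressure gradient»; (2.3) «the 2-nd equation of (2.1) could be
presented as the sum of two equations»): every classical solution with potential force satisfies
`∇p = −∇φ − ½∇(u²)`. Typist's flag: suspicious (uniformly accelerating uniform flow `u = t e₁`, `p = −x₁`,
`φ = 0`). [cite: Ershkov2015, (2.3)–(2.4) p. 4; §8 p. 8] -/
def Step_24 : Prop :=
  ∀ (S : Set ℝ) (ν : ℝ), 0 < ν → ∀ (φ : ℝ → E3 → ℝ) (u : ℝ → E3 → E3) (p : ℝ → E3 → ℝ),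
    IsClassicalNSSolutionOn S ν (potentialForce φ) u p → Holds24 S φ u p

/-- **Step 3 — display (2.5) p. 4** (the other summand of (2.3)): some Helmholtz split of the solution
satisfies `∂(u_p + u_w)/∂t = (u_p + u_w) × (∇ × u_w) + ν∇²u_w` pointwise. Typist's flag: suspicious.
[cite: Ershkov2015, (2.5) p. 4] -/
def Step_25 : Prop :=
  ∀ (S : Set ℝ) (ν : ℝ), 0 < ν → ∀ (φ : ℝ → E3 → ℝ) (u : ℝ → E3 → E3) (p : ℝ → E3 → ℝ),
    IsClassicalNSSolutionOn S ν (potentialForce φ) u p →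
      ∃ (ϕ : ℝ → E3 → ℝ) (uw : ℝ → E3 → E3), IsHelmholtzSplitOn S u ϕ uw ∧
        ∀ t ∈ S, ∀ x : E3,
          timeDerivWithin S u t x = cross (u t x) (curl (uw t) x) + ν • (Δ (uw t)) x

/-- **Step 4 — displays (3.1)–(3.2) p. 5** («Eq. (2.5) should be presented as the sum of two equations
below: ∂u_p/∂t = u_p × w + f [f = u_w × w] (3.1), ∂u_w/∂t = ν∇²u_w (3.2)»; §7 «each component of … u_w … is
proved evidently to be the solution of a proper Heat equation»): some Helmholtz split of every solution
satisfies (3.1) and (3.2). Typist's flag: suspicious — LOAD-BEARING. [cite: Ershkov2015, (3.1)–(3.2) p. 5;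
§7 p. 7] -/
def Step_3132 : Prop :=
  ∀ (S : Set ℝ) (ν : ℝ), 0 < ν → ∀ (φ : ℝ → E3 → ℝ) (u : ℝ → E3 → E3) (p : ℝ → E3 → ℝ),
    IsClassicalNSSolutionOn S ν (potentialForce φ) u p →
      ∃ (ϕ : ℝ → E3 → ℝ) (uw : ℝ → E3 → E3), IsHelmholtzSplitOn S u ϕ uw ∧ Holds3132 S ν u ϕ uw

/-- **Step 5 — p. 5 «Equation (3.2) immediately yields ∂w/∂t = ν∇²w»**: the vorticity of every classical
solution with potential force solves the heat equation. Typist's flag: suspicious (valid GIVEN (3.2); the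
vorticity equation has the stretching/transport term `∇ × (u × w)`). [cite: Ershkov2015, p. 5 after (3.2)] -/
def Step_heatVorticity : Prop :=
  ∀ (S : Set ℝ) (ν : ℝ), 0 < ν → ∀ (φ : ℝ → E3 → ℝ) (u : ℝ → E3 → E3) (p : ℝ → E3 → ℝ),
    IsClassicalNSSolutionOn S ν (potentialForce φ) u p →
      ∀ t ∈ S, ∀ x : E3,
        timeDerivWithin S (fun s y => curl (u s) y) t x = ν • (Δ (fun y => curl (u t) y)) x

/-- **Step 7 — §8's reduction sentence read toward Clay (A)** («the existence of the general solution of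
Navier-Stokes equations is proved to be the question of existence of the proper solution for such a
PDE-system of linear equations»): TYPED as the bridge from the equivalence claim to (A); it carries Δ6 (the
paper states a reduction, not an existence theorem). Typist's flag: suspicious. [cite: Ershkov2015, §8 p. 8] -/
def Step_bridge : Prop :=
  ClaimedTheorem → ClayVariants.clayR3.Regularity

/-! ### Kernel relations -/

/-- **KERNEL COMPOSITION** — the equivalence claim from (2.4) for every solution and the split (3.1)–(3.2).
[cite: Ershkov2015, §4 p. 6] -/
theorem claim_of_steps (h24 : Step_24) (h3132 : Step_3132) : ClaimedTheorem := by
  intro S ν hν φ u p hsol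
  exact ⟨h24 S ν hν φ u p hsol, h3132 S ν hν φ u p hsol⟩

/-- Conversely the claim contains Step 2 and Step 4 (projections). [cite: Ershkov2015, §4 p. 6] -/
theorem steps_of_claim (h : ClaimedTheorem) : Step_24 ∧ Step_3132 :=
  ⟨fun S ν hν φ u p hsol => (h S ν hν φ u p hsol).1,
    fun S ν hν φ u p hsol => (h S ν hν φ u p hsol).2⟩

/-- Clay (A) from the claim and the bridge (modus ponens; MAP's Clay column).
[cite: Ershkov2015, §8 p. 8] -/
theorem clay_of_claimed_and_bridge (hC : ClaimedTheorem) (hbr : Step_bridge) :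
    ClayVariants.clayR3.Regularity :=
  hbr hC

end Literature.Claims.NS.Ershkov2015

end
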